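import Summits.AtomisticToContinuum.Crystallization.Theorems.OverbindingBudgetEnergyFinCert
import Summits.AtomisticToContinuum.Crystallization.Theorems.ChartedPlanarOrderLatticeSmear

/-!
# OverbindingBudget — part XXII-K: the far-layer field is `O(P⁻⁴)` — analytic core of the TAIL leaf (decomp-a2c lens-4, g34)

Part XXII-J typed the tail leaf `LayerFieldTailSum Λ₁ η₁ η₂ s₀ ε` (ANALYTIC·S): the layer fields of the spans `≥ s₀` are summable and
sum to `≥ −ε`.  This file proves the per-span estimate behind it, from lens-3's smearing toolkit (`…ChartedPlanarOrderLatticeSmear`):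

* §1 `lennardJones r ≥ −r⁻⁶/6` always, `|lennardJones r| ≤ r⁻⁶/4` for `r ≥ 1`;
* §2 planar coordinates: a vector orthogonal to the unit normal `n` of independent `a, b` is `c₁ a + c₂ b` (dimension count in `E3`),
  and `‖P n + w‖² = P² + ‖w‖²` for `w ⟂ n`;
* §3 the radial integral `∫₀^∞ (T₂ + r²)⁻³ r dr = T₂⁻²/4` and `∫_{ℝ²} (T₂ + ‖(c₁+z₁)a + (c₂+z₂)b‖²)⁻³ dz = π/(2√G T₂²)`;
* §4 the smeared bound `Σ_{ij} (t² + ‖(i+c₁)a + (j+c₂)b‖²)⁻³ ≤ (1+ε)³ π/(2√G T₂²)`, `T₂ = (1+ε)t² − (1+1/ε)R_c²`, with summability;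
* §5 ★ `layerField_bounds`: for `v` at height `P = ⟪v,n⟫` with `P² ≥ 1` and `T₂ > 0`, the family `lennardJones ‖v + l‖` (`l ∈ ℤa + ℤb`) is
  summable, `layerField a b v ≥ −(1/6)(1+ε)³π/(2√G T₂²)` and `|layerField a b v| ≤ (1/4)(1+ε)³π/(2√G T₂²)`.

The instance `LayerFieldTailSum (17/16) (3/8) (23/20) s₀ (53/s₀³)` (`s₀ ≥ 4`) is assembled from §5 in part XXII-L.
Sorry-free, standard axioms; no instances / notation declared.
-/

noncomputable section

namespace Summit.AtomisticToContinuum.Crystallization.Theorems.OverbindingBudgetEnergyLayerTail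

open MeasureTheory Set Real
open scoped RealInnerProductSpace ENNReal
open Literature.MathematicalPhysics.StatisticalMechanics (lennardJones)
open Summit.AtomisticToContinuum.Crystallization.Theorems.ChartedPlanarOrderChunkFloor (E3)
open Summit.AtomisticToContinuum.Crystallization.Theorems.OverbindingBudgetRegistryCut (IsUnitNormal)
open Summit.AtomisticToContinuum.Crystallization.Theorems.OverbindingBudgetEnergyStraightening (layerField)
open Summit.AtomisticToContinuum.Crystallization.Theorems.ChartedPlanarOrderPairModulus (gram_pos)
open Summit.AtomisticToContinuum.Crystallization.Theorems.ChartedPlanarOrderLatticeSmear (floor_transfer inv_pow_le_of_le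
  tsum_le_lintegral_of_cells lintegral_quadForm)

/-! ## §1 Two bounds on the Lennard-Jones potential -/

/-- `lennardJones r ≥ −r⁻⁶/6` (the repulsive part is non-negative; also at the junk value `r ≤ 0`). -/
theorem lennardJones_ge_neg (r : ℝ) : -(1 / 6 * (r⁻¹) ^ 6) ≤ lennardJones r := by
  unfold lennardJones
  have h : 0 ≤ 1 / 12 * (r⁻¹) ^ 12 := by positivity
  linarith

/-- `|lennardJones r| ≤ r⁻⁶/4` for `r ≥ 1`. -/
theorem abs_lennardJones_le {r : ℝ} (hr : 1 ≤ r) : |lennardJones r| ≤ 1 / 4 * (r⁻¹) ^ 6 := by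
  unfold lennardJones
  have h0 : 0 ≤ (r⁻¹) ^ 6 := by positivity
  have h1 : (r⁻¹) ^ 6 ≤ 1 := pow_le_one₀ (by positivity) (inv_le_one_of_one_le₀ hr)
  have h12 : (r⁻¹) ^ 12 = (r⁻¹) ^ 6 * (r⁻¹) ^ 6 := by ring
  rw [abs_le, h12]
  constructor <;> nlinarith [mul_le_mul_of_nonneg_left h1 h0]

/-! ## §2 Planar coordinates and the Pythagorean split -/

/-- a vector orthogonal to the unit normal of independent `a, b` lies in their span. -/
theorem exists_planar_coords {a b n u : E3} (hab : LinearIndependent ℝ ![a, b]) (hn : IsUnitNormal a b n) (hu : ⟪u, n⟫ = 0) :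
    ∃ c₁ c₂ : ℝ, u = c₁ • a + c₂ • b := by
  obtain ⟨hn1, hna, hnb⟩ := hn
  set K : Submodule ℝ E3 := Submodule.span ℝ (Set.range ![a, b]) with hK
  have hKf : Module.finrank ℝ K = 2 := by
    rw [hK, finrank_span_eq_card hab, Fintype.card_fin]
  have hn0 : n ≠ 0 := by
    intro h
    rw [h, norm_zero] at hn1
    exact zero_ne_one hn1
  have hOf : Module.finrank ℝ (ℝ ∙ n)ᗮ = 2 := by
    have h := Submodule.finrank_add_finrank_orthogonal (ℝ ∙ n)
    have h1 : Module.finrank ℝ (ℝ ∙ n) = 1 := finrank_span_singleton hn0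
    have h3 : Module.finrank ℝ E3 = 3 := finrank_euclideanSpace_fin
    omega
  have hle : K ≤ (ℝ ∙ n)ᗮ := by
    rw [hK, Submodule.span_le]
    rintro _ ⟨i, rfl⟩
    fin_cases i
    · simpa [Submodule.mem_orthogonal_singleton_iff_inner_right] using hna
    · simpa [Submodule.mem_orthogonal_singleton_iff_inner_right] using hnb
  have heq : K = (ℝ ∙ n)ᗮ := Submodule.eq_of_le_of_finrank_eq hle (by rw [hKf, hOf])
  have huK : u ∈ K := by
    rw [heq, Submodule.mem_orthogonal_singleton_iff_inner_right, real_inner_comm]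
    exact hu
  rw [hK, Submodule.mem_span_range_iff_exists_fun] at huK
  obtain ⟨c, hc⟩ := huK
  exact ⟨c 0, c 1, by rw [← hc]; simp [Fin.sum_univ_two]⟩

/-- `‖P n + w‖² = P² + ‖w‖²` for a unit vector `n ⟂ w`. -/
theorem norm_sq_add_planar {n w : E3} {P : ℝ} (hn1 : ‖n‖ = 1) (hw : ⟪n, w⟫ = 0) : ‖P • n + w‖ ^ 2 = P ^ 2 + ‖w‖ ^ 2 := by
  rw [norm_add_sq_real, real_inner_smul_left, hw, mul_zero, norm_smul, Real.norm_eq_abs, hn1, mul_one, sq_abs]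
  ring

/-! ## §3 The radial integral with exponent 3 -/

/-- `∫₀^∞ (T₂ + r²)⁻³ r dr = T₂⁻²/4`. [folklore] -/
theorem integral_Ioi_three {T2 : ℝ} (hT2 : 0 < T2) : ∫ r in Ioi (0:ℝ), ((T2 + r ^ 2)⁻¹) ^ 3 * r = (T2⁻¹) ^ 2 / 4 := by
  have hpos : ∀ r : ℝ, 0 < T2 + r ^ 2 := fun r => by positivity
  have hderiv : ∀ r ∈ Ici (0:ℝ), HasDerivAt (fun r : ℝ => -((T2 + r ^ 2)⁻¹) ^ 2 / 4) (((T2 + r ^ 2)⁻¹) ^ 3 * r) r := by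
    intro r _
    have h1 : HasDerivAt (fun r : ℝ => T2 + r ^ 2) (2 * r) r := by
      simpa using ((hasDerivAt_pow 2 r).const_add T2)
    have h2 : HasDerivAt (fun x : ℝ => (T2 + x ^ 2)⁻¹) (-(2 * r) / (T2 + r ^ 2) ^ 2) r := h1.inv (hpos r).ne'
    have h3 : HasDerivAt (fun x : ℝ => -((T2 + x ^ 2)⁻¹) ^ 2 / 4)
        (-(((2 : ℕ) : ℝ) * ((T2 + r ^ 2)⁻¹) ^ (2 - 1) * (-(2 * r) / (T2 + r ^ 2) ^ 2)) / 4) r := ((h2.pow 2).neg).div_const 4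
    have e : -(((2 : ℕ) : ℝ) * ((T2 + r ^ 2)⁻¹) ^ (2 - 1) * (-(2 * r) / (T2 + r ^ 2) ^ 2)) / 4 = ((T2 + r ^ 2)⁻¹) ^ 3 * r := by
      rw [div_eq_mul_inv (-(2 * r)), ← inv_pow]; push_cast; ring
    rw [e] at h3
    exact h3
  have hlim : Filter.Tendsto (fun r : ℝ => -((T2 + r ^ 2)⁻¹) ^ 2 / 4) Filter.atTop (nhds (-(0:ℝ) ^ 2 / 4)) := by
    have h0 : Filter.Tendsto (fun r : ℝ => T2 + r ^ 2) Filter.atTop Filter.atTop :=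
      Filter.tendsto_atTop_add_const_left _ _ (Filter.tendsto_pow_atTop two_ne_zero)
    exact ((h0.inv_tendsto_atTop).pow 2).neg.div_const 4
  rw [integral_Ioi_of_hasDerivAt_of_nonneg' hderiv (fun r hr => mul_nonneg (by positivity) (le_of_lt hr)) hlim]
  simp only [ne_eq, OfNat.ofNat_ne_zero, not_false_eq_true, zero_pow, neg_zero, zero_div, zero_sub, inv_pow]
  ring

/-- the `ℝ≥0∞` form of `integral_Ioi_three`. -/
theorem lintegral_Ioi_three {T2 : ℝ} (hT2 : 0 < T2) :
    ∫⁻ r in Ioi (0:ℝ), ENNReal.ofReal (((T2 + r ^ 2)⁻¹) ^ 3 * r) = ENNReal.ofReal ((T2⁻¹) ^ 2 / 4) := by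
  have hpos : ∀ r : ℝ, 0 < T2 + r ^ 2 := fun r => by positivity
  have hderiv : ∀ r ∈ Ici (0:ℝ), HasDerivAt (fun r : ℝ => -((T2 + r ^ 2)⁻¹) ^ 2 / 4) (((T2 + r ^ 2)⁻¹) ^ 3 * r) r := by
    intro r _
    have h1 : HasDerivAt (fun r : ℝ => T2 + r ^ 2) (2 * r) r := by
      simpa using ((hasDerivAt_pow 2 r).const_add T2)
    have h2 : HasDerivAt (fun x : ℝ => (T2 + x ^ 2)⁻¹) (-(2 * r) / (T2 + r ^ 2) ^ 2) r := h1.inv (hpos r).ne'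
    have h3 : HasDerivAt (fun x : ℝ => -((T2 + x ^ 2)⁻¹) ^ 2 / 4)
        (-(((2 : ℕ) : ℝ) * ((T2 + r ^ 2)⁻¹) ^ (2 - 1) * (-(2 * r) / (T2 + r ^ 2) ^ 2)) / 4) r := ((h2.pow 2).neg).div_const 4
    have e : -(((2 : ℕ) : ℝ) * ((T2 + r ^ 2)⁻¹) ^ (2 - 1) * (-(2 * r) / (T2 + r ^ 2) ^ 2)) / 4 = ((T2 + r ^ 2)⁻¹) ^ 3 * r := by
      rw [div_eq_mul_inv (-(2 * r)), ← inv_pow]; push_cast; ring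
    rw [e] at h3
    exact h3
  have hlim : Filter.Tendsto (fun r : ℝ => -((T2 + r ^ 2)⁻¹) ^ 2 / 4) Filter.atTop (nhds (-(0:ℝ) ^ 2 / 4)) := by
    have h0 : Filter.Tendsto (fun r : ℝ => T2 + r ^ 2) Filter.atTop Filter.atTop :=
      Filter.tendsto_atTop_add_const_left _ _ (Filter.tendsto_pow_atTop two_ne_zero)
    exact ((h0.inv_tendsto_atTop).pow 2).neg.div_const 4
  have hint := integrableOn_Ioi_deriv_of_nonneg' hderiv (fun r hr => mul_nonneg (by positivity) (le_of_lt hr)) hlim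
  have hnn : 0 ≤ᵐ[volume.restrict (Ioi (0:ℝ))] fun r : ℝ => ((T2 + r ^ 2)⁻¹) ^ 3 * r :=
    (ae_restrict_iff' measurableSet_Ioi).2 (Filter.Eventually.of_forall fun r hr => mul_nonneg (by positivity) (le_of_lt hr))
  rw [← ofReal_integral_eq_lintegral_ofReal hint hnn, integral_Ioi_three hT2]

/-- ★ `n = 3`: `∫_{ℝ²} (T₂ + ‖(c₁+z₁) a + (c₂+z₂) b‖²)⁻³ dz = π/(2 √G T₂²)`. -/
theorem lintegral_quadForm_three {a b : E3} (hab : LinearIndependent ℝ ![a, b]) {T2 : ℝ} (hT2 : 0 < T2) (c₁ c₂ : ℝ) :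
    ∫⁻ z : ℝ × ℝ, ENNReal.ofReal (((T2 + ‖(c₁ + z.1) • a + (c₂ + z.2) • b‖ ^ 2)⁻¹) ^ 3) =
      ENNReal.ofReal (π / (2 * Real.sqrt (‖a‖ ^ 2 * ‖b‖ ^ 2 - ⟪a, b⟫ ^ 2) * T2 ^ 2)) := by
  have hsG : 0 < Real.sqrt (‖a‖ ^ 2 * ‖b‖ ^ 2 - ⟪a, b⟫ ^ 2) := Real.sqrt_pos.2 (gram_pos hab)
  rw [lintegral_quadForm hab hT2.le c₁ c₂ 3, lintegral_Ioi_three hT2, ← ENNReal.ofReal_mul (by positivity),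
    ← ENNReal.ofReal_mul (by positivity)]
  congr 1
  field_simp
  ring

/-! ## §4 The smeared bound for the inverse-cube family -/

/-- ★ `Σ_{ij} (t² + ‖(i+c₁)a + (j+c₂)b‖²)⁻³ ≤ (1+ε)³ π/(2√G T₂²)`, `T₂ = (1+ε)t² − (1+1/ε)R_c² > 0`, `R_c` a bound of `‖ζ₁ a + ζ₂ b‖`
over `|ζ₁|, |ζ₂| ≤ ½`; with summability of the family. -/
theorem tsum_inv_cube_le_smear {a b : E3} (hab : LinearIndependent ℝ ![a, b]) {t Rc ε : ℝ} (hε : 0 < ε)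
    (hRc : ∀ ζ₁ ζ₂ : ℝ, |ζ₁| ≤ 1 / 2 → |ζ₂| ≤ 1 / 2 → ‖ζ₁ • a + ζ₂ • b‖ ≤ Rc)
    (hT : 0 < (1 + ε) * t ^ 2 - (1 + ε⁻¹) * Rc ^ 2) (c₁ c₂ : ℝ) :
    Summable (fun ij : ℤ × ℤ => ((t ^ 2 + ‖((ij.1 : ℝ) + c₁) • a + ((ij.2 : ℝ) + c₂) • b‖ ^ 2)⁻¹) ^ 3) ∧
      ∑' ij : ℤ × ℤ, ((t ^ 2 + ‖((ij.1 : ℝ) + c₁) • a + ((ij.2 : ℝ) + c₂) • b‖ ^ 2)⁻¹) ^ 3 ≤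
        (1 + ε) ^ 3 * (π / (2 * Real.sqrt (‖a‖ ^ 2 * ‖b‖ ^ 2 - ⟪a, b⟫ ^ 2) * ((1 + ε) * t ^ 2 - (1 + ε⁻¹) * Rc ^ 2) ^ 2)) := by
  set T2 := (1 + ε) * t ^ 2 - (1 + ε⁻¹) * Rc ^ 2 with hT2
  set m : ℤ × ℤ → ℝ := fun ij => ‖((ij.1 : ℝ) + c₁) • a + ((ij.2 : ℝ) + c₂) • b‖ with hm
  have hsG : 0 < Real.sqrt (‖a‖ ^ 2 * ‖b‖ ^ 2 - ⟪a, b⟫ ^ 2) := Real.sqrt_pos.2 (gram_pos hab)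
  have hε1 : 0 < 1 + ε := by linarith
  -- the cellwise majorant
  set g : ℝ × ℝ → ℝ≥0∞ := fun z => ENNReal.ofReal
    ((1 + ε) ^ 3 * ((T2 + ‖((c₁ - 1 / 2) + z.1) • a + ((c₂ - 1 / 2) + z.2) • b‖ ^ 2)⁻¹) ^ 3) with hg
  have hF : ∀ (ij : ℤ × ℤ) (z : ℝ × ℝ), z.1 ∈ Ico (ij.1 : ℝ) (ij.1 + 1) → z.2 ∈ Ico (ij.2 : ℝ) (ij.2 + 1) →
      ENNReal.ofReal (((t ^ 2 + m ij ^ 2)⁻¹) ^ 3) ≤ g z := by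
    intro ij z hz1 hz2
    have hdec : ((c₁ - 1 / 2) + z.1) • a + ((c₂ - 1 / 2) + z.2) • b =
        (((ij.1 : ℝ) + c₁) • a + ((ij.2 : ℝ) + c₂) • b) + ((z.1 - ij.1 - 1 / 2) • a + (z.2 - ij.2 - 1 / 2) • b) := by
      module
    have hζ := hRc (z.1 - ij.1 - 1 / 2) (z.2 - ij.2 - 1 / 2) (abs_le.2 ⟨by linarith [hz1.1], by linarith [hz1.2]⟩)
      (abs_le.2 ⟨by linarith [hz2.1], by linarith [hz2.2]⟩)
    have hy : ‖((c₁ - 1 / 2) + z.1) • a + ((c₂ - 1 / 2) + z.2) • b‖ ≤ m ij + Rc := by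
      rw [hdec]; refine (norm_add_le _ _).trans ?_; rw [hm]; linarith
    have hS := floor_transfer (t := t) hε (norm_nonneg _) hy
    have hw : 0 < T2 + ‖((c₁ - 1 / 2) + z.1) • a + ((c₂ - 1 / 2) + z.2) • b‖ ^ 2 := by positivity
    have hwS : 0 < (T2 + ‖((c₁ - 1 / 2) + z.1) • a + ((c₂ - 1 / 2) + z.2) • b‖ ^ 2) / (1 + ε) := div_pos hw hε1
    have h3 := inv_pow_le_of_le 3 hwS hS
    have e3 : (((T2 + ‖((c₁ - 1 / 2) + z.1) • a + ((c₂ - 1 / 2) + z.2) • b‖ ^ 2) / (1 + ε))⁻¹) ^ 3 =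
        (1 + ε) ^ 3 * ((T2 + ‖((c₁ - 1 / 2) + z.1) • a + ((c₂ - 1 / 2) + z.2) • b‖ ^ 2)⁻¹) ^ 3 := by
      rw [inv_div, div_eq_mul_inv, mul_pow]
    rw [e3, ← inv_pow] at h3
    rw [hg]
    exact ENNReal.ofReal_le_ofReal h3
  -- the integral of the majorant
  have hI : ∫⁻ z, g z = ENNReal.ofReal ((1 + ε) ^ 3 * (π / (2 * Real.sqrt (‖a‖ ^ 2 * ‖b‖ ^ 2 - ⟪a, b⟫ ^ 2) * T2 ^ 2))) := by
    have hm3 : Measurable fun z : ℝ × ℝ =>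
        ENNReal.ofReal (((T2 + ‖((c₁ - 1 / 2) + z.1) • a + ((c₂ - 1 / 2) + z.2) • b‖ ^ 2)⁻¹) ^ 3) := by fun_prop
    have e1 : ∀ z : ℝ × ℝ, g z = ENNReal.ofReal ((1 + ε) ^ 3) *
        ENNReal.ofReal (((T2 + ‖((c₁ - 1 / 2) + z.1) • a + ((c₂ - 1 / 2) + z.2) • b‖ ^ 2)⁻¹) ^ 3) := by
      intro z
      rw [hg, ← ENNReal.ofReal_mul (by positivity)]
    simp_rw [e1]
    rw [lintegral_const_mul _ hm3, lintegral_quadForm_three hab hT (c₁ - 1 / 2) (c₂ - 1 / 2), ← ENNReal.ofReal_mul (by positivity)]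
  -- conclusion
  have hle : ∑' ij : ℤ × ℤ, ENNReal.ofReal (((t ^ 2 + m ij ^ 2)⁻¹) ^ 3) ≤ _ := (tsum_le_lintegral_of_cells _ g hF).trans_eq hI
  have hne : ∑' ij : ℤ × ℤ, ENNReal.ofReal (((t ^ 2 + m ij ^ 2)⁻¹) ^ 3) ≠ ⊤ := ne_top_of_le_ne_top ENNReal.ofReal_ne_top hle
  have hsum : Summable fun ij : ℤ × ℤ => ((t ^ 2 + m ij ^ 2)⁻¹) ^ 3 := by
    refine (ENNReal.summable_toReal hne).congr fun ij => ?_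
    exact ENNReal.toReal_ofReal (by positivity)
  refine ⟨hsum, ?_⟩
  have e2 : ∑' ij : ℤ × ℤ, ((t ^ 2 + m ij ^ 2)⁻¹) ^ 3 = (∑' ij : ℤ × ℤ, ENNReal.ofReal (((t ^ 2 + m ij ^ 2)⁻¹) ^ 3)).toReal := by
    rw [ENNReal.tsum_toReal_eq (fun _ => ENNReal.ofReal_ne_top)]
    exact tsum_congr fun ij => (ENNReal.toReal_ofReal (by positivity)).symm
  show ∑' ij : ℤ × ℤ, ((t ^ 2 + m ij ^ 2)⁻¹) ^ 3 ≤ _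
  rw [e2]
  refine (ENNReal.toReal_mono ENNReal.ofReal_ne_top hle).trans ?_
  rw [ENNReal.toReal_ofReal (by positivity)]

/-! ## §5 ★ The per-span bound on the layer field -/

/-- ★★ THE FAR-LAYER FIELD IS `O(P⁻⁴)`.  For independent periods `a, b` with unit normal `n`, a cell radius `R_c`, `ε > 0` and a point
`v` at height `P = ⟪v, n⟫` with `P² ≥ 1` and `T₂ = (1+ε)P² − (1+1/ε)R_c² > 0`: the family `lennardJones ‖v + (i a + j b)‖` is summable,
`layerField a b v ≥ −(1/6)(1+ε)³π/(2√G T₂²)` and `|layerField a b v| ≤ (1/4)(1+ε)³π/(2√G T₂²)`. -/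
theorem layerField_bounds {a b n v : E3} (hab : LinearIndependent ℝ ![a, b]) (hn : IsUnitNormal a b n) {Rc ε : ℝ} (hε : 0 < ε)
    (hRc : ∀ ζ₁ ζ₂ : ℝ, |ζ₁| ≤ 1 / 2 → |ζ₂| ≤ 1 / 2 → ‖ζ₁ • a + ζ₂ • b‖ ≤ Rc)
    (hT : 0 < (1 + ε) * ⟪v, n⟫ ^ 2 - (1 + ε⁻¹) * Rc ^ 2) (hP : 1 ≤ ⟪v, n⟫ ^ 2) :
    Summable (fun ij : ℤ × ℤ => lennardJones ‖v + (((ij.1 : ℤ) : ℝ) • a + ((ij.2 : ℤ) : ℝ) • b)‖) ∧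
      -(1 / 6 * ((1 + ε) ^ 3 * (π / (2 * Real.sqrt (‖a‖ ^ 2 * ‖b‖ ^ 2 - ⟪a, b⟫ ^ 2) *
          ((1 + ε) * ⟪v, n⟫ ^ 2 - (1 + ε⁻¹) * Rc ^ 2) ^ 2)))) ≤ layerField a b v ∧
      |layerField a b v| ≤ 1 / 4 * ((1 + ε) ^ 3 * (π / (2 * Real.sqrt (‖a‖ ^ 2 * ‖b‖ ^ 2 - ⟪a, b⟫ ^ 2) *
          ((1 + ε) * ⟪v, n⟫ ^ 2 - (1 + ε⁻¹) * Rc ^ 2) ^ 2))) := by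
  have hn' := hn
  obtain ⟨hn1, hna, hnb⟩ := hn'
  set P := ⟪v, n⟫ with hPdef
  have hu : ⟪v - P • n, n⟫ = 0 := by
    rw [inner_sub_left, real_inner_smul_left, real_inner_self_eq_norm_sq, hn1]; ring
  obtain ⟨c₁, c₂, hc⟩ := exists_planar_coords hab hn hu
  -- the Pythagorean split of every distance
  have hdist : ∀ ij : ℤ × ℤ, ‖v + (((ij.1 : ℤ) : ℝ) • a + ((ij.2 : ℤ) : ℝ) • b)‖ ^ 2 =
      P ^ 2 + ‖((ij.1 : ℝ) + c₁) • a + ((ij.2 : ℝ) + c₂) • b‖ ^ 2 := by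
    intro ij
    have hv : v = P • n + (c₁ • a + c₂ • b) := by rw [← hc]; abel
    have hv' : v + (((ij.1 : ℤ) : ℝ) • a + ((ij.2 : ℤ) : ℝ) • b) = P • n + ((((ij.1 : ℝ) + c₁) • a + ((ij.2 : ℝ) + c₂) • b)) := by
      rw [hv, add_smul, add_smul]; abel
    have hw : ⟪n, ((ij.1 : ℝ) + c₁) • a + ((ij.2 : ℝ) + c₂) • b⟫ = 0 := by
      rw [inner_add_right, real_inner_smul_right, real_inner_smul_right, hna, hnb]; ring
    rw [hv', norm_sq_add_planar hn1 hw]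
  -- the majorant family
  obtain ⟨hFs, hFle⟩ := tsum_inv_cube_le_smear hab (t := P) hε hRc hT c₁ c₂
  have hr1 : ∀ ij : ℤ × ℤ, 1 ≤ ‖v + (((ij.1 : ℤ) : ℝ) • a + ((ij.2 : ℤ) : ℝ) • b)‖ := by
    intro ij
    have h2 : 1 ≤ ‖v + (((ij.1 : ℤ) : ℝ) • a + ((ij.2 : ℤ) : ℝ) • b)‖ ^ 2 := by rw [hdist ij]; nlinarith [sq_nonneg ‖((ij.1 : ℝ) + c₁) • a + ((ij.2 : ℝ) + c₂) • b‖]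
    nlinarith [norm_nonneg (v + (((ij.1 : ℤ) : ℝ) • a + ((ij.2 : ℤ) : ℝ) • b)), h2]
  have hinv6 : ∀ ij : ℤ × ℤ, (‖v + (((ij.1 : ℤ) : ℝ) • a + ((ij.2 : ℤ) : ℝ) • b)‖⁻¹) ^ 6 =
      ((P ^ 2 + ‖((ij.1 : ℝ) + c₁) • a + ((ij.2 : ℝ) + c₂) • b‖ ^ 2)⁻¹) ^ 3 := by
    intro ij
    rw [show (‖v + (((ij.1 : ℤ) : ℝ) • a + ((ij.2 : ℤ) : ℝ) • b)‖⁻¹) ^ 6 = ((‖v + (((ij.1 : ℤ) : ℝ) • a + ((ij.2 : ℤ) : ℝ) • b)‖⁻¹) ^ 2) ^ 3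
      by ring, inv_pow, hdist ij]
  have hlo : ∀ ij : ℤ × ℤ, -(1 / 6 * ((P ^ 2 + ‖((ij.1 : ℝ) + c₁) • a + ((ij.2 : ℝ) + c₂) • b‖ ^ 2)⁻¹) ^ 3) ≤
      lennardJones ‖v + (((ij.1 : ℤ) : ℝ) • a + ((ij.2 : ℤ) : ℝ) • b)‖ := by
    intro ij; rw [← hinv6 ij]; exact lennardJones_ge_neg _
  have habs : ∀ ij : ℤ × ℤ, |lennardJones ‖v + (((ij.1 : ℤ) : ℝ) • a + ((ij.2 : ℤ) : ℝ) • b)‖| ≤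
      1 / 4 * ((P ^ 2 + ‖((ij.1 : ℝ) + c₁) • a + ((ij.2 : ℝ) + c₂) • b‖ ^ 2)⁻¹) ^ 3 := by
    intro ij; rw [← hinv6 ij]; exact abs_lennardJones_le (hr1 ij)
  have hLs : Summable (fun ij : ℤ × ℤ => lennardJones ‖v + (((ij.1 : ℤ) : ℝ) • a + ((ij.2 : ℤ) : ℝ) • b)‖) :=
    Summable.of_norm_bounded (hFs.mul_left (1 / 4)) (fun ij => by rw [Real.norm_eq_abs]; exact habs ij)
  refine ⟨hLs, ?_, ?_⟩
  · have h1 := Summable.tsum_le_tsum hlo ((hFs.mul_left (1 / 6)).neg) hLs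
    rw [tsum_neg, tsum_mul_left] at h1
    unfold layerField
    linarith
  · have h2 : ‖∑' ij : ℤ × ℤ, lennardJones ‖v + (((ij.1 : ℤ) : ℝ) • a + ((ij.2 : ℤ) : ℝ) • b)‖‖ ≤
        ∑' ij : ℤ × ℤ, ‖lennardJones ‖v + (((ij.1 : ℤ) : ℝ) • a + ((ij.2 : ℤ) : ℝ) • b)‖‖ := norm_tsum_le_tsum_norm hLs.norm
    have h3 := Summable.tsum_le_tsum (fun ij => by rw [Real.norm_eq_abs]; exact habs ij) hLs.norm (hFs.mul_left (1 / 4))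
    rw [tsum_mul_left] at h3
    rw [Real.norm_eq_abs] at h2
    unfold layerField
    linarith

end Summit.AtomisticToContinuum.Crystallization.Theorems.OverbindingBudgetEnergyLayerTail
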